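import Literature.Analysis.FluidPDE.KNSSRegularityGalileanProofs
import Literature.Analysis.FluidPDE.OseenHeatKernelBridge
import Literature.Analysis.FluidPDE.KNSSOseenMildDecayTools
import Literature.Analysis.FluidPDE.ForcedOseenMildPeriodic
import Literature.Analysis.FluidPDE.NSBoundedMildSmoothing
import Literature.Analysis.UnboundedOperators.HeatKernelBoundedData
import Literature.Analysis.FluidPDE.KNSSWeakDriftMild
import Literature.Analysis.FluidPDE.SolenoidalL2Duality
import Literature.Analysis.FluidPDE.ClassicalSolution
import Literature.Analysis.FluidPDE.SelfSimilar
import HarnessLib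

/-!
# Crux `FrequencyRigidity` (stmt-NavierStokesRegularity-2955), line `two-ended-pinning`,
# stub S3b `stub_galileanOseenIdentity` — the zero-drift Oseen identity in the co-moving frame

Helper file (lands `--supports stmt-NavierStokesRegularity-2955`; theorems only) proving the
registered stub `stub_galileanOseenIdentity` of skeleton v6 of the line. Let `(u, p)` be a
classical solution of Navier–Stokes (`ν = 1`, no force) on `(−∞, 0) × ℝ³` with Type I decay in
time `‖u(σ, ·)‖ ≤ C/√(−σ)`, and let `β : (−∞, 0) → ℝ³` be a continuous drift for which the
*intrinsic drift identity* `u(t) − e^{(t−s)Δ}u(s) + B¹_s(u,u)(t) = β(t) − β(s)` holds for all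
`s < t < 0` (the output of stub S3a). Then for all `a < s < t < 0` the co-moving,
drift-subtracted field `ū(σ, z) = u(σ, z + ∫ₐ^σ β) − β(σ)` satisfies the **zero-drift** Oseen
integral identity `ū(t) = e^{(t−s)Δ}ū(s) − B¹_s(ū, ū)(t)` pointwise.

## Proof

Pure bookkeeping over the tree's proved Galilean covariance of KNSS's drift-mild class
(`IsKNSSDriftMild.galileanCovariance_R3`). Fix `a < s < t < 0`, the window `(a, t')`, `t' = t/2`,
of length `T = t' − a`, and window coordinates `τ = σ − a`, clamped into `[a, t']` by a continuous
clock `κ` with `κ τ = τ + a` on `[0, T]`. The pair `U' τ = u(κ τ) − β(κ τ)`, `b' τ = β(κ τ)` is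
drift-mild on `(0, T)` (`driftMild_window`): joint measurability from joint continuity, the
bound `N = C/√(−t') + sup_{[a,t']} ‖β‖`, weak divergence-freeness of every slice
(`VectorCalculus.IsDivFree.isWeaklyDivFree_holds`, `isWeaklyDivFree_const`,
`IsWeaklyDivFree.sub_of_locallyIntegrable`), and the drift-mild identity, which is the intrinsic
drift identity once `e^{τΔ}(u − c) = e^{τΔ}u − c` (`heatExtension_sub_of_bound`,
`heatExtension_const`) and `driftDuhamel U' b' = B¹(u(· + a), u(· + a))`
(`driftDuhamel_congr_ae`, `driftDuhamel_zero_eq_oseenDuhamel`, `oseenDuhamel_translate`) are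
inserted. Galilean covariance makes `V = galileanShift U' b'` drift-mild with zero drift, and
`IsKNSSDriftMild.eq_heatExtension_sub_oseenDuhamel` at the window times `s − a < t − a` is the
claim, after identifying the frame path `driftPath b' τ = ∫ₐ^{τ+a} β` (`driftPath_window`) and
translating the Duhamel term back in time (`oseenDuhamel_translate`,
`oseenDuhamel_congr_of_eqOn_Ioo`).

## References

* G. Koch, N. Nadirashvili, G. Seregin, V. Šverák, *Liouville theorems for the Navier–Stokes
  equations and applications*, Acta Math. 203 (2009) 83–105 = arXiv:0709.3599, §1 p. 3 (parasitic
  solutions and the co-moving frame), §4 (4.3)–(4.4). [KochNadirashviliSereginSverak2009]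
-/

set_option linter.dupNamespace false

noncomputable section

namespace Summit.NavierStokesRegularity.NavierStokesRegularity.Theorems.FrequencyRigidity.TwoEndedPinning

open Literature.Analysis Literature.Analysis.FluidPDE MeasureTheory Set Filter Topology Function

/-- **The frame path of a re-clocked drift.** If the clock `κ` satisfies `κ ρ = ρ + a` on
`[0, T]`, then `∫₀^τ β(κ ρ) dρ = ∫ₐ^{τ+a} β` for `τ ∈ [0, T]` (change of variables `ρ ↦ ρ + a`).
[folklore] -/
theorem driftPath_window {β : ℝ → EuclideanSpace ℝ (Fin 3)} {κ : ℝ → ℝ} {a T τ : ℝ}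
    (hκw : ∀ ρ ∈ Icc (0 : ℝ) T, κ ρ = ρ + a) (hτ : τ ∈ Icc (0 : ℝ) T) :
    driftPath (fun ρ => β (κ ρ)) τ = ∫ ρ in a..(τ + a), β ρ := by
  rw [driftPath]
  have h1 : ∫ ρ in (0 : ℝ)..τ, β (κ ρ) = ∫ ρ in (0 : ℝ)..τ, β (ρ + a) := by
    refine intervalIntegral.integral_congr fun ρ hρ => ?_
    rw [uIcc_of_le hτ.1] at hρ
    show β (κ ρ) = β (ρ + a)
    rw [hκw ρ ⟨hρ.1, hρ.2.trans hτ.2⟩]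
  rw [h1, intervalIntegral.integral_comp_add_right, zero_add]

/-- **The cut-off, re-clocked, drift-subtracted pair is drift-mild on the window.** Let `(u, p)`
be a classical Navier–Stokes solution on `(−∞, 0) × ℝ³` with Type I time decay (constant `C`),
`β` a continuous drift on `(−∞, 0)` obeying the intrinsic drift identity
`u(t) − e^{(t−s)Δ}u(s) + B¹_s(u,u)(t) = β(t) − β(s)` (`s < t < 0`), and `κ` a continuous clock
with values in `[a, t'] ⊂ (−∞, 0)` and `κ τ = τ + a` on `[0, t' − a]`. Then
`(τ, z) ↦ u(κ τ, z) − β(κ τ)` with drift `τ ↦ β(κ τ)` is drift-mild on `(0, t' − a)` in the sense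
of KNSS (`IsKNSSDriftMild`), with some bound `N`. [cite: KochNadirashviliSereginSverak2009, §4 (i)–(ii) and (4.3)–(4.4) (arXiv:0709.3599v1 p. 8)] -/
theorem driftMild_window {C : ℝ} {u : ℝ → EuclideanSpace ℝ (Fin 3) → EuclideanSpace ℝ (Fin 3)}
    {p : ℝ → EuclideanSpace ℝ (Fin 3) → ℝ} {β : ℝ → EuclideanSpace ℝ (Fin 3)}
    (hns : IsClassicalNSSolutionOn (Iio 0) 1 0 u p) (hT1 : HasTypeITimeDecay C u)
    (hβ : ContinuousOn β (Iio 0))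
    (hid : ∀ s t : ℝ, s < t → t < 0 → ∀ y : EuclideanSpace ℝ (Fin 3),
      u t y - UnboundedOperators.heatExtension (u s) (t - s) y + oseenDuhamel 1 s u u t y =
        β t - β s)
    {a t' : ℝ} (ht'0 : t' < 0) {κ : ℝ → ℝ} (hκc : Continuous κ)
    (hκm : ∀ τ, κ τ ∈ Icc a t') (hκw : ∀ τ ∈ Icc (0 : ℝ) (t' - a), κ τ = τ + a) :
    ∃ N : ℝ, IsKNSSDriftMild (t' - a) N (fun τ z => u (κ τ) z - β (κ τ)) (fun τ => β (κ τ)) := by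
  have hE : Module.finrank ℝ (EuclideanSpace ℝ (Fin 3)) = 3 := finrank_euclideanSpace_fin
  -- `0 ≤ C` (Type I at one point)
  have hC : 0 ≤ C := by
    have h := hT1 (-1) (by norm_num) 0
    rw [neg_neg, Real.sqrt_one, div_one] at h
    exact (norm_nonneg _).trans h
  -- slices of `u` are continuous, and uniformly bounded up to time `t'`
  have hu_cont : ∀ σ : ℝ, σ < 0 → Continuous (u σ) := fun σ hσ =>
    (hns.contDiff_velocity (mem_Iio.2 hσ)).continuous
  have hsq : 0 < Real.sqrt (-t') := Real.sqrt_pos.2 (neg_pos.2 ht'0)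
  have hu_bd : ∀ σ : ℝ, σ ≤ t' → ∀ z : EuclideanSpace ℝ (Fin 3), ‖u σ z‖ ≤ C / Real.sqrt (-t') :=
    fun σ hσ z => (hT1 σ (hσ.trans_lt ht'0) z).trans
      (div_le_div_of_nonneg_left hC hsq (Real.sqrt_le_sqrt (neg_le_neg hσ)))
  -- a bound for the drift on `[a, t']`
  obtain ⟨M, hM⟩ := (isCompact_Icc (a := a) (b := t')).exists_bound_of_continuousOn
    (hβ.mono fun σ hσ => mem_Iio.2 (hσ.2.trans_lt ht'0))
  -- continuity of the re-clocked drift and of the re-clocked field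
  have hκ0 : ∀ τ, κ τ < 0 := fun τ => (hκm τ).2.trans_lt ht'0
  have hbc : Continuous fun τ => β (κ τ) :=
    hβ.comp_continuous hκc fun τ => mem_Iio.2 (hκ0 τ)
  have hUc : Continuous (uncurry fun τ z => u (κ τ) z - β (κ τ)) := by
    have h1 : Continuous fun q : ℝ × EuclideanSpace ℝ (Fin 3) => uncurry u (κ q.1, q.2) :=
      hns.smooth_velocity.continuousOn.comp_continuous
        ((hκc.comp continuous_fst).prodMk continuous_snd)
        fun q => mk_mem_prod (mem_Iio.2 (hκ0 q.1)) (mem_univ _)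
    have h2 : Continuous fun q : ℝ × EuclideanSpace ℝ (Fin 3) => β (κ q.1) :=
      hbc.comp continuous_fst
    exact h1.sub h2
  have hCsq : 0 ≤ C / Real.sqrt (-t') := div_nonneg hC (Real.sqrt_nonneg _)
  refine ⟨C / Real.sqrt (-t') + M,
    { measurable_drift := hbc.measurable
      norm_drift_le := fun τ => (hM _ (hκm τ)).trans (le_add_of_nonneg_left hCsq)
      measurable := hUc.measurable
      norm_le := fun τ _ z => ?_
      ae_isWeaklyDivFree := Eventually.of_forall fun τ => ?_
      mild := fun σ' τ' hσ' hσ'τ' hτ'T x => ?_ }⟩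
  · -- the bound on the window (in fact everywhere)
    show ‖u (κ τ) z - β (κ τ)‖ ≤ C / Real.sqrt (-t') + M
    exact (norm_sub_le _ _).trans (add_le_add (hu_bd _ (hκm τ).2 z) (hM _ (hκm τ)))
  · -- every slice is weakly divergence free
    show IsWeaklyDivFree fun z => u (κ τ) z - β (κ τ)
    have hmem : κ τ ∈ Iio 0 := mem_Iio.2 (hκ0 τ)
    have h1 : IsWeaklyDivFree (u (κ τ)) :=
      VectorCalculus.IsDivFree.isWeaklyDivFree_holds (hns.divFree _ hmem)
        ((hns.contDiff_velocity hmem).of_le (by exact_mod_cast le_top))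
    exact h1.sub_of_locallyIntegrable (isWeaklyDivFree_const (β (κ τ)))
      (hu_cont _ (hκ0 τ)).locallyIntegrable continuous_const.locallyIntegrable
  · -- the drift-mild identity on the window = the intrinsic drift identity, re-clocked
    show u (κ τ') x - β (κ τ') =
      UnboundedOperators.heatExtension (fun z => u (κ σ') z - β (κ σ')) (τ' - σ') x -
        driftDuhamel (fun τ z => u (κ τ) z - β (κ τ)) (fun τ => β (κ τ)) σ' τ' x
    have hκσ : κ σ' = σ' + a := hκw σ' ⟨hσ'.le, (hσ'τ'.trans hτ'T).le⟩
    have hκτ : κ τ' = τ' + a := hκw τ' ⟨(hσ'.trans hσ'τ').le, hτ'T.le⟩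
    have hs₁0 : σ' + a < 0 := by linarith
    have ht₁0 : τ' + a < 0 := by linarith
    have hpos : 0 < τ' - σ' := sub_pos.2 hσ'τ'
    rw [hκτ, hκσ]
    -- the caloric term
    rw [UnboundedOperators.heatExtension_sub_of_bound (hu_cont _ hs₁0) continuous_const
        (hu_bd _ (by linarith)) (fun _ => le_rfl) hpos x,
      UnboundedOperators.heatExtension_const _ hpos x]
    -- the Duhamel term
    have hDD : driftDuhamel (fun τ z => u (κ τ) z - β (κ τ)) (fun τ => β (κ τ)) σ' τ' x =
        oseenDuhamel 1 (σ' + a) u u (τ' + a) x := by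
      have step1 : driftDuhamel (fun τ z => u (κ τ) z - β (κ τ)) (fun τ => β (κ τ)) σ' τ' x =
          driftDuhamel (fun τ => u (τ + a)) 0 σ' τ' x := by
        refine driftDuhamel_congr_ae hσ'τ'.le ?_ x
        rw [ae_restrict_iff' measurableSet_Ioo]
        refine Eventually.of_forall fun σ hσ => Eventually.of_forall fun y => ?_
        have hκσσ : κ σ = σ + a := hκw σ ⟨(hσ'.trans hσ.1).le, (hσ.2.trans hτ'T).le⟩
        show u (κ σ) y - β (κ σ) + β (κ σ) = u (σ + a) y + (0 : ℝ → EuclideanSpace ℝ (Fin 3)) σ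
        rw [sub_add_cancel, Pi.zero_apply, add_zero, hκσσ]
      have step2 : driftDuhamel (fun τ => u (τ + a)) 0 σ' τ' x =
          oseenDuhamel 1 σ' (fun τ => u (τ + a)) (fun τ => u (τ + a)) τ' x :=
        driftDuhamel_zero_eq_oseenDuhamel hE
          (fun σ hσ => (hu_cont (σ + a) (by linarith [hσ.2])).measurable)
          (fun σ hσ y => hu_bd (σ + a) (by linarith [hσ.2]) y) hσ'τ'.le x
      rw [step1, step2, oseenDuhamel_translate]
    rw [hDD]
    -- the intrinsic drift identity between `σ' + a < τ' + a < 0`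
    have key := hid (σ' + a) (τ' + a) (by linarith) ht₁0 x
    rw [show τ' + a - (σ' + a) = τ' - σ' by ring] at key
    rw [← sub_eq_zero] at key ⊢
    rw [← key]
    abel

/-- **Stub S3b of the line `two-ended-pinning` (skeleton v6): the zero-drift Oseen identity in the
co-moving frame.** For a classical Navier–Stokes solution `(u, p)` on `(−∞, 0) × ℝ³` (`ν = 1`, no
force) with Type I time decay, a continuous drift `β` on `(−∞, 0)`, and the intrinsic drift
identity `u(t) − e^{(t−s)Δ}u(s) + B¹_s(u,u)(t) = β(t) − β(s)` (`s < t < 0`), the co-moving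
drift-subtracted field `ū(σ, z) = u(σ, z + ∫ₐ^σ β) − β(σ)` satisfies, for all `a < s < t < 0` and
`y`, `ū(t, y) = e^{(t−s)Δ}ū(s)(y) − B¹_s(ū, ū)(t)(y)`. Proof: Galilean covariance of KNSS's
drift-mild class (`IsKNSSDriftMild.galileanCovariance_R3`) applied to the window pair of
`driftMild_window`, read through `IsKNSSDriftMild.eq_heatExtension_sub_oseenDuhamel`.
[cite: KochNadirashviliSereginSverak2009, §1 p. 3 and §4 (4.3)–(4.4) (arXiv:0709.3599v1)] -/
theorem stub_galileanOseenIdentity :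
    ∀ (C : ℝ) (u : ℝ → EuclideanSpace ℝ (Fin 3) → EuclideanSpace ℝ (Fin 3))
      (p : ℝ → EuclideanSpace ℝ (Fin 3) → ℝ) (β : ℝ → EuclideanSpace ℝ (Fin 3)),
      Literature.Analysis.FluidPDE.IsClassicalNSSolutionOn (Set.Iio 0) 1 0 u p →
      Literature.Analysis.FluidPDE.HasTypeITimeDecay C u →
      ContinuousOn β (Set.Iio 0) →
      (∀ s t : ℝ, s < t → t < 0 → ∀ y : EuclideanSpace ℝ (Fin 3),
        u t y - Literature.Analysis.UnboundedOperators.heatExtension (u s) (t - s) y +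
            Literature.Analysis.FluidPDE.oseenDuhamel 1 s u u t y = β t - β s) →
      ∀ a s t : ℝ, a < s → s < t → t < 0 → ∀ y : EuclideanSpace ℝ (Fin 3),
        u t (y + ∫ ρ in a..t, β ρ) - β t =
          Literature.Analysis.UnboundedOperators.heatExtension
              (fun z => u s (z + ∫ ρ in a..s, β ρ) - β s) (t - s) y -
            Literature.Analysis.FluidPDE.oseenDuhamel 1 s
              (fun σ z => u σ (z + ∫ ρ in a..σ, β ρ) - β σ)
              (fun σ z => u σ (z + ∫ ρ in a..σ, β ρ) - β σ) t y := by
  intro C u p β hns hT1 hβ hid a s t has hst ht0 y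
  have hE : Module.finrank ℝ (EuclideanSpace ℝ (Fin 3)) = 3 := finrank_euclideanSpace_fin
  -- the window `(a, t')`, `t' = t / 2`, and the clamped clock `κ`
  set t' : ℝ := t / 2 with ht'
  have htt' : t < t' := by rw [ht']; linarith
  have ht'0 : t' < 0 := by rw [ht']; linarith
  have hat' : a < t' := by linarith
  obtain ⟨κ, hκc, hκm, hκw⟩ : ∃ κ : ℝ → ℝ, Continuous κ ∧ (∀ τ, κ τ ∈ Icc a t') ∧
      ∀ τ ∈ Icc (0 : ℝ) (t' - a), κ τ = τ + a := by
    refine ⟨fun τ => max a (min (τ + a) t'),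
      continuous_const.max ((continuous_id.add continuous_const).min continuous_const),
      fun τ => ⟨le_max_left _ _, max_le hat'.le (min_le_right _ _)⟩, fun τ hτ => ?_⟩
    show max a (min (τ + a) t') = τ + a
    rw [min_eq_left (by linarith [hτ.2]), max_eq_right (by linarith [hτ.1])]
  -- the window pair is drift-mild; its Galilean transform is drift-mild with zero drift
  obtain ⟨N, hdm⟩ := driftMild_window hns hT1 hβ hid ht'0 hκc hκm hκw
  have hV := IsKNSSDriftMild.galileanCovariance_R3 hdm
  have hsa : 0 < s - a := sub_pos.2 has
  have hsata : s - a < t - a := by linarith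
  have htaT : t - a < t' - a := by linarith
  have key := hV.eq_heatExtension_sub_oseenDuhamel hE hsa hsata htaT y
  -- the frame path and the clock at the window times
  have hP : ∀ τ ∈ Icc (0 : ℝ) (t' - a),
      driftPath (fun ρ => β (κ ρ)) τ = ∫ ρ in a..(τ + a), β ρ := fun τ hτ =>
    driftPath_window hκw hτ
  have htmem : t - a ∈ Icc (0 : ℝ) (t' - a) := ⟨by linarith, htaT.le⟩
  have hsmem : s - a ∈ Icc (0 : ℝ) (t' - a) := ⟨hsa.le, by linarith⟩
  have hPt : driftPath (fun ρ => β (κ ρ)) (t - a) = ∫ ρ in a..t, β ρ := by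
    rw [hP _ htmem, sub_add_cancel]
  have hPs : driftPath (fun ρ => β (κ ρ)) (s - a) = ∫ ρ in a..s, β ρ := by
    rw [hP _ hsmem, sub_add_cancel]
  have hκt : κ (t - a) = t := by rw [hκw _ htmem, sub_add_cancel]
  have hκs : κ (s - a) = s := by rw [hκw _ hsmem, sub_add_cancel]
  -- the three terms of the zero-drift identity, back in the original clock
  have hVt : galileanShift (fun τ z => u (κ τ) z - β (κ τ)) (fun τ => β (κ τ)) (t - a) y =
      u t (y + ∫ ρ in a..t, β ρ) - β t := by
    simp only [galileanShift_apply]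
    rw [hκt, hPt]
  have hVs : galileanShift (fun τ z => u (κ τ) z - β (κ τ)) (fun τ => β (κ τ)) (s - a) =
      fun z => u s (z + ∫ ρ in a..s, β ρ) - β s := by
    funext z
    simp only [galileanShift_apply]
    rw [hκs, hPs]
  have hVτ : ∀ τ ∈ Ioo (s - a) (t - a),
      galileanShift (fun τ z => u (κ τ) z - β (κ τ)) (fun τ => β (κ τ)) τ =
        fun z => u (τ + a) (z + ∫ ρ in a..(τ + a), β ρ) - β (τ + a) := by
    intro τ hτ
    have hτmem : τ ∈ Icc (0 : ℝ) (t' - a) := ⟨(hsa.trans hτ.1).le, (hτ.2.trans htaT).le⟩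
    funext z
    simp only [galileanShift_apply]
    rw [hκw _ hτmem, hP _ hτmem]
  have hD : oseenDuhamel 1 (s - a)
      (galileanShift (fun τ z => u (κ τ) z - β (κ τ)) (fun τ => β (κ τ)))
      (galileanShift (fun τ z => u (κ τ) z - β (κ τ)) (fun τ => β (κ τ))) (t - a) y =
      oseenDuhamel 1 s (fun σ z => u σ (z + ∫ ρ in a..σ, β ρ) - β σ)
        (fun σ z => u σ (z + ∫ ρ in a..σ, β ρ) - β σ) t y := by
    rw [oseenDuhamel_congr_of_eqOn_Ioo hVτ hVτ y]
    have h3 := oseenDuhamel_translate 1 (s - a) a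
      (fun σ z => u σ (z + ∫ ρ in a..σ, β ρ) - β σ)
      (fun σ z => u σ (z + ∫ ρ in a..σ, β ρ) - β σ) (t - a) y
    rw [sub_add_cancel, sub_add_cancel] at h3
    exact h3
  rw [hVt, hVs, hD, show t - a - (s - a) = t - s by ring] at key
  exact key

end Summit.NavierStokesRegularity.NavierStokesRegularity.Theorems.FrequencyRigidity.TwoEndedPinning

end
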